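import Summits.Ventures.QEC.CircuitDistance.K2TablesBB72
import HarnessLib

/-!
# K2 cube facts for `[[72,12,6]]`, Z-sector: the five `K2DFS` pivot cubes return `true` (plain `decide`, kernel)

Cell `qec`, CDX (R144 (2)). With qec-cdx-type-1's soundness theorem for `K2DFS.cube` and the well-formedness link of `d_bb72Z` to
the Port tables, these five facts give the K2 binders for `[[72,12,6]]` (`List_≤3 = ∅`, `List_≤5 ⊆` the listed orbits) — here they
are just the computations (idea-1 CARD-5 trial: 90 / 1 023 / 4 245 / 15 519 / 33 569 visits, X; Z similar). No `native_decide`.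
-/

namespace Summit.Ventures.QEC.CircuitDistance.K2DFS

set_option maxRecDepth 100000 in
set_option maxHeartbeats 4000000000 in
/-- KERNEL FACT: pivot cube 0 of the Z-sector K2 DFS of `[[72,12,6]]` accepts (every non-trivial stop is a listed word). -/
theorem cube0_bb72Z : cube d_bb72Z 0 1532495540865888858358347027150309183618739122183602174 T0_bb72Z = true := by
  decide

set_option maxRecDepth 100000 in
set_option maxHeartbeats 4000000000 in
/-- KERNEL FACT: pivot cube 1 of the Z-sector K2 DFS of `[[72,12,6]]` accepts (every non-trivial stop is a listed word). -/
theorem cube1_bb72Z : cube d_bb72Z 36 1532495540865888858358347027150309183618738984744648704 T1_bb72Z = true := by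
  decide

set_option maxRecDepth 100000 in
set_option maxHeartbeats 4000000000 in
/-- KERNEL FACT: pivot cube 2 of the Z-sector K2 DFS of `[[72,12,6]]` accepts (every non-trivial stop is a listed word). -/
theorem cube2_bb72Z : cube d_bb72Z 72 1532495540865888858358347027150299738885773382893174784 T2_bb72Z = true := by
  decide

set_option maxRecDepth 100000 in
set_option maxHeartbeats 4000000000 in
/-- KERNEL FACT: pivot cube 3 of the Z-sector K2 DFS of `[[72,12,6]]` accepts (every non-trivial stop is a listed word). -/
theorem cube3_bb72Z : cube d_bb72Z 108 1532495540865888858357697990042992330165172810142449664 T3_bb72Z = true := by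
  decide

set_option maxRecDepth 100000 in
set_option maxHeartbeats 4000000000 in
/-- KERNEL FACT: pivot cube 4 of the Z-sector K2 DFS of `[[72,12,6]]` accepts (every non-trivial stop is a listed word). -/
theorem cube4_bb72Z : cube d_bb72Z 144 1532495540821287367961285780867237747073442399171641344 T4_bb72Z = true := by
  decide

end Summit.Ventures.QEC.CircuitDistance.K2DFS
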